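import Literature.NumberTheory.EllipticCurves.BSDRootNumberSmallConductorProofs
import Literature.NumberTheory.EllipticCurves.TamagawaFiniteIndexProofs
import Literature.NumberTheory.EllipticCurves.Skinner2016.RankZeroPPart
import Literature.NumberTheory.EllipticCurves.YanZhu2026.PPartBSD
import Literature.NumberTheory.EllipticCurves.LeadingTermPPartRankLeOne
import Literature.NumberTheory.EllipticCurves.Rank1Residual.Predicates
import Literature.NumberTheory.EllipticCurves.Rank1Residual.PrintShape
import Literature.NumberTheory.EllipticCurves.Rank1Residual.X9SmallImage
import Literature.NumberTheory.EllipticCurves.Wuthrich2014.ThreeAdicImage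
import Literature.NumberTheory.DiophantineGeometry.LocalReduction
import HarnessLib

/-!
# BSD in analytic rank `≤ 1` over `ℚ`, residual class X10 (`p = 3` good ordinary, `E[3]`
# irreducible, off the printed floor): what closes from PUBLISHED theorems

HONEST FRAMING. This file belongs to the cell `bsd-rank1-residual` (home
`run/shared/lean/b2b/bsd-rank1-residual/`, audit `X10-AUDIT.md`), whose goal is to DELETE the
combination-shaped residual classes of `papers/BirchSwinnertonDyer/bsd-percentage/RESIDUAL-CASES.md`
§a.2 for analytic-rank `≤ 1` curves over `ℚ` by assembling `BSD(E,p)` STRICTLY from published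
theorems taken as named facts (D-0014) — so that the remainder becomes exactly the
construction-shaped classes. It is NOT "finishing BSD": every theorem below is conditional on the
named facts it lists, and nothing here bears on analytic rank `≥ 2`.

Class **X10** (`RESIDUAL-CASES.md` §a.2, predicates of `bsdN/HYPOTHESES.md`): `ord(3)` (good
reduction at `3`, `3 ∤ a_3`) `∧ irr(3)` (`E[3]` irreducible) `∧ [(r = 0 ∧ ¬ram(3)) ∨ (r = 1 ∧ ¬sst)]`,
where `r` is the analytic rank (the census decides `r = 0` as `L(E,1) ≠ 0` by modular symbols),
`ram(3)` = "∃ a prime `q ≠ 3` of multiplicative reduction with `E[3]` ramified at `q`"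
(`3 ∤ v_q(Δ_min)`), `sst` = `E` semistable. `BSD(E,p)` is Miller's (LMS J. Comput. Math. 14 (2011)
Def. 1.1), the tree's `Literature.NumberTheory.EllipticCurves.BSDp`.

## What this file proves (all at `p = 3` unless stated; named facts as explicit hypotheses)

* `bsdp_of_padicValRat_eq` — bookkeeping bridge: the "`p`-part of BSD" in the shape printed by
  the Iwasawa-theoretic literature (`L^{(r)}(E,1)/r! = q·Reg·Ω`, `ord_p q = ord_p #Ш + ord_p ∏c_ℓ -
  2 ord_p #E(ℚ)_tors`, `Ш` finite, `rank = r_an`, `q ≠ 0`) implies `BSDp W p`.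
* `bsdp_of_rank_le_one_of_ram` / `…_of_padicSurjective` (any odd good ordinary `p` with
  `E[p]` irreducible, any conductor): from Yan–Zhu, J. Algebra (2026) Thm. 4.15
  (`YanZhu2026.thm415_padicValRat_bsd_rank_le_one`) with (Im) witnessed by a ramified
  multiplicative prime (Skinner 2016 §2.5) resp. by `p`-adic surjectivity, plus
  Gross–Zagier–Kolyvagin (bsd.S17 `rank_eq_analyticRank_of_analyticRank_le_one`) for `rank = r_an`.
  At `p = 3` these are `X10.bsdp_three_of_ram` (28 of the 30 rank-1 X10 pairs with `N < 10⁴` carry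
  `ram = True` on the 2026-08-18T16:56:26Z collector) and `X10.bsdp_three_of_padicSurjective`
  (the rank-0 `¬ram(3)` pairs with `3`-adically surjective image).
* `bsdp_three_of_L_one_ne_zero_of_ram` — class C1 at `p = 3` (rank `0`, good ordinary or
  multiplicative `3`, (irr) + (ram)) from Skinner, Pacific J. Math. 283 (2016) Thm. C
  (`Skinner2016.thmC_padicValRat_bsd_rank_zero`), with NO surjectivity of `ρ̄_{E,3}` and no
  `3`-adic image condition — the published text behind retiring the census caveat `SU14@3`.

What is NOT closed here (see `X10-AUDIT.md`): X10 pairs with `¬ram(3)` whose `3`-adic image is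
not surjective — when `3 ∤ #ρ̄_{E,3}(G_ℚ)` no element `τ` with `T_3E/(τ-1) ≅ ℤ_3` exists at all, so
(Im) fails structurally (the `p = 3` analogue of class X9); census instances `N < 10⁴`:
`1210k1`, `7442c1` (rank 1), `1690i1`, `6050x1` (rank 0).

## References

* X. Yan, X. Zhu, J. Algebra (2026), doi:10.1016/j.jalgebra.2026.01.016 = arXiv:2412.20078,
  Thm. 4.15 / Cor. 1.4.
* C. Skinner, Pacific J. Math. 283 (2016) 171–200, Thm. C, footnote 1, §2.5.
* R. L. Miller, LMS J. Comput. Math. 14 (2011), Def. 1.1 (`BSD(E,p)`).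
* H. Darmon, CBMS 101 (2004), Thm. 3.22 (Gross–Zagier–Kolyvagin).
-/

noncomputable section

open scoped Classical NumberField

open WeierstrassCurve

namespace Literature.NumberTheory.EllipticCurves.Rank1Residual

variable {W : WeierstrassCurve ℚ}

/-! ### Analytic-rank bookkeeping (unconditional) -/

/-- `L(E,1) ≠ 0` forces analytic rank `0` — unconditionally (no continuation needed): the order
of vanishing `analyticOrderNatAt L 1` is `0` when `L(1) ≠ 0`, whether or not `L` is analytic at `1`
(Mathlib's junk value for a non-analytic germ is also `0`). [folklore] -/
theorem analyticRank_eq_zero_of_entireLFunction_one_ne_zero (hL : W.entireLFunction 1 ≠ 0) :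
    W.analyticRank = 0 := by
  unfold WeierstrassCurve.analyticRank analyticOrderNatAt
  by_cases han : AnalyticAt ℂ W.entireLFunction 1
  · rw [han.analyticOrderAt_eq_zero.mpr hL]; rfl
  · rw [analyticOrderAt_of_not_analyticAt han]; rfl

/-- A POSITIVE analytic rank forces the leading Taylor coefficient `L^{(r)}(E,1)/r!` to be
nonzero — unconditionally: `r = analyticOrderNatAt L 1 ≠ 0` means `L` is analytic at `1` with
order of vanishing exactly `r` (a non-analytic or identically vanishing germ has `analyticOrderNatAt
= 0`), and then `L^{(r)}(1) ≠ 0` by `natCast_le_analyticOrderAt_iff_iteratedDeriv_eq_zero` (same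
argument as `WeierstrassCurve.leadingLCoeff_ne_zero_holds`, which instead assumes an entire
continuation to cover `r = 0`). [folklore] -/
theorem leadingLCoeff_ne_zero_of_analyticRank_ne_zero (hr : W.analyticRank ≠ 0) :
    W.leadingLCoeff ≠ 0 := by
  have hne : analyticOrderAt W.entireLFunction 1 ≠ 0 := by
    intro h0
    apply hr
    unfold WeierstrassCurve.analyticRank analyticOrderNatAt
    rw [h0]; rfl
  have han : AnalyticAt ℂ W.entireLFunction 1 := by
    by_contra h
    exact hne (analyticOrderAt_of_not_analyticAt h)
  have hnetop : analyticOrderAt W.entireLFunction 1 ≠ ⊤ := by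
    intro htop
    apply hr
    unfold WeierstrassCurve.analyticRank analyticOrderNatAt
    rw [htop]; rfl
  have hra : (W.analyticRank : ℕ∞) = analyticOrderAt W.entireLFunction 1 := by
    unfold WeierstrassCurve.analyticRank analyticOrderNatAt
    exact ENat.coe_toNat hnetop
  have hderiv : iteratedDeriv W.analyticRank W.entireLFunction 1 ≠ 0 := by
    intro h0
    have hle : ((W.analyticRank + 1 : ℕ) : ℕ∞) ≤ analyticOrderAt W.entireLFunction 1 := by
      rw [natCast_le_analyticOrderAt_iff_iteratedDeriv_eq_zero han]
      intro i hi
      rcases Nat.lt_succ_iff_lt_or_eq.mp hi with hi | rfl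
      · exact (natCast_le_analyticOrderAt_iff_iteratedDeriv_eq_zero han).mp hra.le i hi
      · exact h0
    rw [← hra] at hle
    exact absurd (by exact_mod_cast hle : W.analyticRank + 1 ≤ W.analyticRank) (by omega)
  unfold WeierstrassCurve.leadingLCoeff
  exact div_ne_zero hderiv (by exact_mod_cast (Nat.factorial_pos _).ne')

/-! ### From the printed `p`-part shape to Miller's `BSD(E,p)` -/

variable [W.IsElliptic]

/-- **Bridge to Miller's `BSD(E,p)`.** If `rank_ℤ E(ℚ) = r_an`, `Ш(E/ℚ)` is finite, and
`L^{(r)}(E,1)/r! = q · Reg(E/ℚ) · Ω(W)` for a rational `q ≠ 0` with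
`ord_p q = ord_p #Ш + ord_p ∏_ℓ c_ℓ - 2·ord_p #E(ℚ)_tors` — the shape in which the `p`-part of the
BSD formula is printed by Skinner–Urban 2014 Thm. 2, Skinner 2016 Thm. C, Jetchev–Skinner–Wan 2017
(1.2), Yan–Zhu 2026 Thm. 4.15 — then `BSD(E,p)` in the sense of Miller, LMS J. Comput. Math. 14
(2011) Def. 1.1 (`BSDp W p`): `#Ш_an = q · #E(ℚ)_tors² / ∏ c_ℓ` is rational with
`ord_p #Ш_an = ord_p #Ш = ord_p #Ш(p)` (`padicValNat_card_addPrimaryComponent`).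
[cite: Miller2011LMS, Def. 1.1 (arXiv:1010.2431 p. 3)] -/
theorem bsdp_of_padicValRat_eq (p : ℕ) [Fact p.Prime]
    (hrank : W.mordellWeilRank = W.analyticRank) (hfin : Finite W.sha) (q : ℚ) (hq0 : q ≠ 0)
    (hq : W.leadingLCoeff = (((q : ℝ) * W.regulator * W.realPeriodRat : ℝ) : ℂ))
    (hval : padicValRat p q = (padicValNat p W.shaOrder : ℤ) + padicValNat p W.tamagawaProduct -
      2 * padicValNat p W.torsionOrder) :
    BSDp W p := by
  have hfinp : Finite (AddCommGroup.primaryComponent W.sha p) := inferInstance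
  refine ⟨hrank, hfinp, q * (W.torsionOrder : ℚ) ^ 2 / (W.tamagawaProduct : ℚ), ?_, ?_⟩
  · -- `#Ш_an = L^{(r)}(E,1)/r! · #tors² / (Ω · ∏c · Reg) = q · #tors² / ∏c`
    have hΩpos : 0 < W.realPeriodRat := by
      haveI : (W.baseChange ℝ).IsElliptic := by rw [baseChange]; infer_instance
      exact (W.baseChange ℝ).realPeriod_pos'
    have hΩ : (W.realPeriodRat : ℂ) ≠ 0 := by exact_mod_cast hΩpos.ne'
    have hR : (W.regulator : ℂ) ≠ 0 := by exact_mod_cast (W.regulator_pos').ne'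
    have hc : (W.tamagawaProduct : ℂ) ≠ 0 := by exact_mod_cast (W.tamagawaProduct_pos').ne'
    rw [shaAn_def, hq]
    push_cast
    field_simp
  · -- valuations: `ord_p (q·#tors²/∏c) = ord_p q + 2 ord_p #tors - ord_p ∏c = ord_p #Ш = ord_p #Ш(p)`
    have ht0 : (W.torsionOrder : ℚ) ≠ 0 := by exact_mod_cast (W.torsionOrder_pos_holds).ne'
    have hc0 : (W.tamagawaProduct : ℚ) ≠ 0 := by exact_mod_cast (W.tamagawaProduct_pos').ne'
    haveI : Finite W.sha := hfin
    have h2 : padicValRat p ((W.torsionOrder : ℚ) ^ 2) = 2 * padicValRat p (W.torsionOrder : ℚ) := by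
      rw [pow_two, padicValRat.mul ht0 ht0]; ring
    rw [padicValNat_card_addPrimaryComponent, padicValRat.div (mul_ne_zero hq0 (pow_ne_zero 2 ht0))
      hc0, padicValRat.mul hq0 (pow_ne_zero 2 ht0), h2, hval, padicValRat.of_nat, padicValRat.of_nat]
    unfold WeierstrassCurve.shaOrder
    ring

/-! ### The `p`-part in analytic rank `≤ 1` with a ramified multiplicative prime or a
`p`-adically surjective image (Yan–Zhu 2026 + Skinner 2016 §2.5 + Gross–Zagier–Kolyvagin) -/

variable [W.IsGloballyMinimal]

/-- **`BSD(E,p)` in analytic rank `≤ 1` at an odd good ordinary irreducible `p` with a ramified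
multiplicative prime, any conductor.** Conditional on the named facts `hYZ` (Yan–Zhu, J. Algebra
(2026) Thm. 4.15, with (Im) witnessed by tame inertia at the multiplicative prime `ℓ` — Skinner
2016 §2.5) and `hGZK` (Gross–Zagier–Kolyvagin, bsd.S17: `rank = r_an ≤ 1`). Hypotheses: `W` a
globally minimal model of `E`; `p ≥ 3` good (`hgood`) ordinary (`hord`); `E[p]` irreducible
(`hirr`); `ram(p)` (`hram`: `ℓ ≠ p` multiplicative with `p ∤ v_ℓ(Δ_min)`); the analytic rank is `0`
in the decided form `L(E,1) ≠ 0`, or `1` (`hr`). This covers, at `p = 3`, every non-semistable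
rank-1 curve with a ramified multiplicative prime (outside Jetchev–Skinner–Wan's semistability and
Burungale–Castella–Skinner's `p > 3`). [cite: YanZhu2024MainConjNonCM, Thm. 4.15 (§4.6)] -/
theorem bsdp_of_rank_le_one_of_ram
    (hYZ : YanZhu2026.thm415_padicValRat_bsd_rank_le_one)
    (hGZK : rank_eq_analyticRank_of_analyticRank_le_one) (p : ℕ) [Fact p.Prime] (hp : 3 ≤ p)
    (hgood : W.HasGoodReductionAtPrime p) (hord : ¬ (p : ℤ) ∣ W.frobeniusTrace p)
    (hirr : W.HasIrreducibleModPGaloisRep p)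
    (hram : ∃ ℓ : ℕ, ∃ _ : Fact ℓ.Prime, ℓ ≠ p ∧ W.HasMultiplicativeReductionAtPrime ℓ ∧
      ¬ p ∣ padicValInt ℓ W.minimalDiscriminantInt)
    (hr : W.entireLFunction 1 ≠ 0 ∨ W.analyticRank = 1) : BSDp W p := by
  have hr1 : W.analyticRank ≤ 1 := by
    rcases hr with hL | h1
    · rw [analyticRank_eq_zero_of_entireLFunction_one_ne_zero hL]; exact zero_le_one
    · exact h1.le
  have hq0' : W.leadingLCoeff ≠ 0 := by
    rcases hr with hL | h1
    · rw [WeierstrassCurve.leadingLCoeff, analyticRank_eq_zero_of_entireLFunction_one_ne_zero hL,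
        iteratedDeriv_zero, Nat.factorial_zero, Nat.cast_one, div_one]
      exact hL
    · exact leadingLCoeff_ne_zero_of_analyticRank_ne_zero (by rw [h1]; exact one_ne_zero)
  obtain ⟨hmw, -⟩ := hGZK W hr1
  obtain ⟨hfin, q, hq, hval⟩ := hYZ W p hp hgood hord hirr (Or.inr hram) hr1
  have hq0 : q ≠ 0 := by
    rintro rfl
    apply hq0'
    rw [hq]; push_cast; ring
  exact bsdp_of_padicValRat_eq p hmw hfin q hq0 hq hval

/-- **`BSD(E,p)` in analytic rank `≤ 1` at an odd good ordinary irreducible `p` with `p`-adically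
surjective Galois image (all `ρ̄_{E,p^n}` surjective), any conductor.** Conditional on `hYZ`
(Yan–Zhu 2026 Thm. 4.15; (Im) holds with `τ = (1 1; 0 1) ∈ SL₂(ℤ_p) = ρ_E(G_{ℚ(μ_{p^∞})})`) and
`hGZK` (bsd.S17). At `p = 3`, `3`-adic surjectivity is decided by the mod-`9` image (Elkies 2006;
Rouse–Sutherland–Zureick-Brown, Forum Math. Sigma 10 (2022)); mod-`3` surjectivity alone does NOT
suffice. [cite: YanZhu2024MainConjNonCM, Thm. 4.15 (§4.6)] -/
theorem bsdp_of_rank_le_one_of_padicSurjective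
    (hYZ : YanZhu2026.thm415_padicValRat_bsd_rank_le_one)
    (hGZK : rank_eq_analyticRank_of_analyticRank_le_one) (p : ℕ) [Fact p.Prime] (hp : 3 ≤ p)
    (hgood : W.HasGoodReductionAtPrime p) (hord : ¬ (p : ℤ) ∣ W.frobeniusTrace p)
    (hirr : W.HasIrreducibleModPGaloisRep p)
    (hsurj : ∀ n : ℕ, W.HasSurjectiveModNGaloisRep (p ^ n : ℕ))
    (hr : W.entireLFunction 1 ≠ 0 ∨ W.analyticRank = 1) : BSDp W p := by
  have hr1 : W.analyticRank ≤ 1 := by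
    rcases hr with hL | h1
    · rw [analyticRank_eq_zero_of_entireLFunction_one_ne_zero hL]; exact zero_le_one
    · exact h1.le
  have hq0' : W.leadingLCoeff ≠ 0 := by
    rcases hr with hL | h1
    · rw [WeierstrassCurve.leadingLCoeff, analyticRank_eq_zero_of_entireLFunction_one_ne_zero hL,
        iteratedDeriv_zero, Nat.factorial_zero, Nat.cast_one, div_one]
      exact hL
    · exact leadingLCoeff_ne_zero_of_analyticRank_ne_zero (by rw [h1]; exact one_ne_zero)
  obtain ⟨hmw, -⟩ := hGZK W hr1
  obtain ⟨hfin, q, hq, hval⟩ := hYZ W p hp hgood hord hirr (Or.inl hsurj) hr1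
  have hq0 : q ≠ 0 := by
    rintro rfl
    apply hq0'
    rw [hq]; push_cast; ring
  exact bsdp_of_padicValRat_eq p hmw hfin q hq0 hq hval

/-! ### Class X10 at `p = 3` -/

/-- **X10, rank-1 non-semistable (or rank-0) branch with `ram(3)`: `BSD(E,3)`.** The X10 predicate
`ord(3) ∧ irr(3)` with the analytic rank decided as `L(E,1) ≠ 0` or `r_an = 1`, plus `ram(3)`;
non-semistability is not needed (and not used). From Yan–Zhu 2026 Thm. 4.15 (`hYZ`) and
Gross–Zagier–Kolyvagin (`hGZK`). Census reach: 28 of the 30 rank-1 X10 pairs `N < 10⁴`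
(`residue_classes_v3.tsv`, `ram = True`). [cite: YanZhu2024MainConjNonCM, Thm. 4.15 (§4.6)] -/
theorem X10.bsdp_three_of_ram
    (hYZ : YanZhu2026.thm415_padicValRat_bsd_rank_le_one)
    (hGZK : rank_eq_analyticRank_of_analyticRank_le_one)
    (hgood : W.HasGoodReductionAtPrime 3) (hord : ¬ (3 : ℤ) ∣ W.frobeniusTrace 3)
    (hirr : W.HasIrreducibleModPGaloisRep 3)
    (hram : ∃ ℓ : ℕ, ∃ _ : Fact ℓ.Prime, ℓ ≠ 3 ∧ W.HasMultiplicativeReductionAtPrime ℓ ∧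
      ¬ 3 ∣ padicValInt ℓ W.minimalDiscriminantInt)
    (hr : W.entireLFunction 1 ≠ 0 ∨ W.analyticRank = 1) : BSDp W 3 :=
  bsdp_of_rank_le_one_of_ram hYZ hGZK 3 le_rfl hgood (by exact_mod_cast hord) hirr hram hr

/-- **X10 with `3`-adically surjective image: `BSD(E,3)`** (either rank; this is the route for
the rank-0 `¬ram(3)` branch). From Yan–Zhu 2026 Thm. 4.15 (`hYZ`) and Gross–Zagier–Kolyvagin
(`hGZK`). [cite: YanZhu2024MainConjNonCM, Thm. 4.15 (§4.6)] -/
theorem X10.bsdp_three_of_padicSurjective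
    (hYZ : YanZhu2026.thm415_padicValRat_bsd_rank_le_one)
    (hGZK : rank_eq_analyticRank_of_analyticRank_le_one)
    (hgood : W.HasGoodReductionAtPrime 3) (hord : ¬ (3 : ℤ) ∣ W.frobeniusTrace 3)
    (hirr : W.HasIrreducibleModPGaloisRep 3)
    (hsurj : ∀ n : ℕ, W.HasSurjectiveModNGaloisRep (3 ^ n : ℕ))
    (hr : W.entireLFunction 1 ≠ 0 ∨ W.analyticRank = 1) : BSDp W 3 :=
  bsdp_of_rank_le_one_of_padicSurjective hYZ hGZK 3 le_rfl hgood (by exact_mod_cast hord) hirr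
    hsurj hr

/-! ### Class C1 at `p = 3` without the `SU14@3` caveat (Skinner 2016, Thm. C) -/

/-- **`BSD(E,3)` in analytic rank `0` at good ordinary or multiplicative `3` with (irr) + (ram),
from Skinner 2016 Thm. C** (`hSk`; no surjectivity of `ρ̄_{E,3}`, no `3`-adic image hypothesis:
footnote 1 and §2.5 of the source) and Gross–Zagier–Kolyvagin (`hGZK`: `E(ℚ)` has rank `0` and
`Ш` is finite when `L(E,1) ≠ 0`). This is the census row T-SU / T-SK at `p = 3` (classes C1 and
X11's complement) with the literal-caveat flags `SU14@3`, `SK16-irr-only` retired by the printed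
text. [cite: Skinner2016PacificMC, Thm. C (§1), footnote 1, §2.5] -/
theorem bsdp_three_of_L_one_ne_zero_of_ram
    (hSk : Skinner2016.thmC_padicValRat_bsd_rank_zero)
    (hGZK : rank_eq_analyticRank_of_analyticRank_le_one)
    (hred : (W.HasGoodReductionAtPrime 3 ∧ ¬ (3 : ℤ) ∣ W.frobeniusTrace 3) ∨
      W.HasMultiplicativeReductionAtPrime 3)
    (hirr : W.HasIrreducibleModPGaloisRep 3)
    (hram : ∃ ℓ : ℕ, ∃ _ : Fact ℓ.Prime, ℓ ≠ 3 ∧ W.HasMultiplicativeReductionAtPrime ℓ ∧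
      ¬ 3 ∣ padicValInt ℓ W.minimalDiscriminantInt)
    (hL : W.entireLFunction 1 ≠ 0) : BSDp W 3 := by
  have hr0 : W.analyticRank = 0 := analyticRank_eq_zero_of_entireLFunction_one_ne_zero hL
  obtain ⟨hmw, hfin⟩ := hGZK W (by rw [hr0]; exact zero_le_one)
  have hmw0 : W.mordellWeilRank = 0 := by rw [hmw, hr0]
  obtain ⟨q, hq, hval⟩ := hSk W 3 le_rfl (by exact_mod_cast hred) hirr hram hL hfin
  have hΩpos : 0 < W.realPeriodRat := by
    haveI : (W.baseChange ℝ).IsElliptic := by rw [baseChange]; infer_instance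
    exact (W.baseChange ℝ).realPeriod_pos'
  have hΩ : (W.realPeriodRat : ℂ) ≠ 0 := by exact_mod_cast hΩpos.ne'
  rw [div_eq_iff hΩ] at hq
  have hq0 : q ≠ 0 := by
    rintro rfl
    apply hL
    rw [hq]; simp
  refine bsdp_of_padicValRat_eq 3 hmw hfin q hq0 ?_ hval
  rw [WeierstrassCurve.leadingLCoeff, hr0, iteratedDeriv_zero, Nat.factorial_zero, Nat.cast_one,
    div_one, W.regulator_eq_one_of_rank_zero hmw0, mul_one, hq]
  push_cast; ring

/-! ### Appendix (2026-08-18, after referee audit C1 / ruling R6.1): the canonical class shape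
over the cell's predicates `ClassX10`, `Ram`, `BigIm` (file `Rank1Residual/Predicates`), with the
status FLAG of the Yan–Zhu input repeated as the referee requires (REFEREE.md F5/C1; wording
FINAL per rulings R9.1/R10.1, which supersede the flag names `YZ26-BF-equiv` and
`YZ26@3-r1-BCK-analogy` used in this file's docstrings when it landed): **PUB\*** —
`YZ26@3-BF-ERL-Ohta`: "Yan–Zhu 2026 Thm. 4.7 (Beilinson–Flach equivalence) — statement in print at
`p ∤ 2N` (Burungale–Castella–Skinner, IMRN 2025, Thm. 4.1.3; Castella–Grossi–Skinner 2025,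
Prop. 3.2.1; Yan–Zhu 2026, Thm. 4.7); every printed proof pointer → BSTW arXiv:2409.01350 §9.3.2 /
BST (PREPRINTS); the explicit reciprocity laws in Hida families are printed for `p ≥ 5` only
(Kings–Loeffler–Zerbes, Camb. J. Math. 2017, §7.2 'We assume, for the remainder of this paper, that
p ≥ 5'; Lei–Loeffler–Zerbes, Compositio 2015, §1.1/§5.3; Fukaya–Kato 2024); at `p = 3` the `Λ`-adic
Eichler–Shimura input rests on Sangiovanni Vincentelli–Skinner (PREPRINT): Cais, Compositio 154
(2018), Cor. 15/16 covers ONLY the closed-curve (cuspidal) row of BSTW Thm. 3.1, not the open-curve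
row `𝓗¹_ord(Y₁)/M_Λ` used at the Eisenstein prime (referee F23, pages cited there)". The earlier
rank-one flag `YZ26@3-r1-BCK-analogy` is RETIRED (R9.1 (ii): the Howard-type input of Yan–Zhu's
rank-one leg is Castella–Grossi–Skinner 2025, Thm. 5.5.2, published at `p ∤ 2N`; the [BCK] analogy
of Thm. 4.14 is not load-bearing for `BSD_3`). Under the cell's standard ("assembled from PUBLISHED
theorems"; a refereed statement is cited as printed) the classes closed through Thm. 4.15 are
"closed (PUB\*)" carrying this flag, as the census reports JSW's supersingular case; the two-tier
reading of R9.1 (iii) ("PUB statement / PRE proof-input at `p = 3`" for the 28 rank-one X10a′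
census pairs) is recorded in HOME/CLASSES.md and the paper's classes table. The extra binder `hmod : hasEntireLFunction_rat`
(modularity ⇒ entire continuation, Wiles / Breuil–Conrad–Diamond–Taylor; a named tree fact) is used
only to read the class's clause `r_an = 0` as `L(E,1) ≠ 0` (`analyticRank_eq_zero_iff_holds`). -/

omit [W.IsGloballyMinimal] in
/-- In analytic rank `≤ 1`, granted the entire continuation of `L(E,s)` (modularity, `hmod`), the
rank clause takes the DECIDED form `L(E,1) ≠ 0 ∨ r_an = 1` used by the theorems above
(`analyticRank_eq_zero_iff_holds`). [cite: BCDTJAMS2001, Theorem A] -/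
theorem entireLFunction_one_ne_zero_or_analyticRank_eq_one (hmod : hasEntireLFunction_rat)
    (hr : W.analyticRank ≤ 1) : W.entireLFunction 1 ≠ 0 ∨ W.analyticRank = 1 := by
  rcases Nat.le_one_iff_eq_zero_or_eq_one.mp hr with h0 | h1
  · exact Or.inl ((W.analyticRank_eq_zero_iff_holds (hmod W)).mp h0)
  · exact Or.inr h1

omit [W.IsElliptic] in
/-- The class predicate `ClassX10 W p` forces analytic rank `≤ 1` (its rank clause is `r = 0 ∨ r = 1`).
Bookkeeping on RESIDUAL-CASES §a.2 row X10. [folklore] -/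
theorem ClassX10.analyticRank_le_one {p : ℕ} [Fact p.Prime]
    (hX : ClassX10 W p) : W.analyticRank ≤ 1 := by
  rcases hX.2.2.2 with ⟨h0, -⟩ | ⟨h1, -⟩
  · rw [h0]; exact zero_le_one
  · rw [h1]

/-- **`BSD(E,p)` for analytic rank `≤ 1` at an odd good ordinary prime with `E[p]` irreducible and
(Im), any conductor — the GENERAL printed form of Yan–Zhu, J. Algebra (2026) Thm. 4.15 over the
cell's predicate `BigIm`** (named fact `hYZ : YanZhu2026.thm415_padicValRat_bsd_rank_le_one_of_bigIm`),
with Gross–Zagier–Kolyvagin (`hGZK`, bsd.S17) and modularity (`hmod`, to read `r_an = 0` as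
`L(E,1) ≠ 0`). STATUS PUB\* — flag `YZ26@3-BF-ERL-Ohta` (final wording: module appendix note;
the earlier names `YZ26-BF-equiv` / `YZ26@3-r1-BCK-analogy` are superseded / retired, referee
R9.1/R10.1). At `p ≥ 5` this is subsumed by
Burungale–Castella–Skinner 2025 Cor. 1.3.1; its new reach is exactly `p = 3`.
[cite: YanZhu2024MainConjNonCM, Thm. 4.15 (§4.6), hypothesis (Im)] -/
theorem bsdp_of_goodOrd_irr_bigIm
    (hYZ : YanZhu2026.thm415_padicValRat_bsd_rank_le_one_of_bigIm)
    (hGZK : rank_eq_analyticRank_of_analyticRank_le_one) (hmod : hasEntireLFunction_rat)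
    (p : ℕ) [Fact p.Prime] (hp : 3 ≤ p) (hord : GoodOrd W p) (hirr : Irr W p) (hIm : BigIm W p)
    (hr : W.analyticRank ≤ 1) : BSDp W p := by
  have hr' := entireLFunction_one_ne_zero_or_analyticRank_eq_one hmod hr
  have hq0' : W.leadingLCoeff ≠ 0 := W.leadingLCoeff_ne_zero_holds (hmod W)
  obtain ⟨hmw, -⟩ := hGZK W hr
  obtain ⟨hfin, q, hq, hval⟩ := hYZ W p hp hord.1 hord.2 hirr hIm hr
  have hq0 : q ≠ 0 := by
    rintro rfl
    apply hq0'
    rw [hq]; push_cast; ring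
  exact bsdp_of_padicValRat_eq p hmw hfin q hq0 hq hval

/-- **X10 ∩ (Im): `ClassX10 W 3 → BigIm W 3 → BSDp W 3`** (both rank branches of the class), from
Yan–Zhu 2026 Thm. 4.15 in its general (Im) form (`hYZ`), GZK (`hGZK`), modularity (`hmod`).
STATUS PUB\*: flag `YZ26@3-BF-ERL-Ohta` (module appendix note; referee R9.1/R10.1). The
complement `ClassX10 W 3 ∧ ¬ BigIm W 3` is the part of X10 NOT closed by any published theorem
(referee ruling R6.1: X10b, the `p = 3` instance of class X9's obstruction).
[cite: YanZhu2024MainConjNonCM, Thm. 4.15 (§4.6), hypothesis (Im)] -/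
theorem bsdp_of_classX10_of_bigIm
    (hYZ : YanZhu2026.thm415_padicValRat_bsd_rank_le_one_of_bigIm)
    (hGZK : rank_eq_analyticRank_of_analyticRank_le_one) (hmod : hasEntireLFunction_rat)
    (hX : ClassX10 W 3) (hIm : BigIm W 3) : BSDp W 3 :=
  bsdp_of_goodOrd_irr_bigIm hYZ hGZK hmod 3 le_rfl hX.2.1 hX.2.2.1 hIm hX.analyticRank_le_one

/-- **X10 ∩ ram(3): `ClassX10 W 3 → Ram W 3 → BSDp W 3`** (by the class predicate this is the
rank-one, non-semistable branch: the `r = 0` branch of X10 has `¬ram(3)`), from Yan–Zhu 2026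
Thm. 4.15 with (Im) witnessed by the ramified multiplicative prime (Skinner 2016 §2.5) — fact `hYZ`
in its special-case form — GZK (`hGZK`) and modularity (`hmod`). STATUS PUB\*: flag
`YZ26@3-BF-ERL-Ohta` (module appendix note; referee R9.1/R10.1). Census reach (collector
2026-08-18T16:56:26Z): 28 of the 30 rank-one X10 pairs with `N < 10⁴` (the two-tier reading "PUB
statement / PRE proof-input at `p = 3`" of R9.1 (iii) applies to exactly these 28). [cite: YanZhu2024MainConjNonCM, Thm. 4.15 (§4.6)] -/
theorem bsdp_of_classX10_of_ram
    (hYZ : YanZhu2026.thm415_padicValRat_bsd_rank_le_one)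
    (hGZK : rank_eq_analyticRank_of_analyticRank_le_one) (hmod : hasEntireLFunction_rat)
    (hX : ClassX10 W 3) (hram : Ram W 3) : BSDp W 3 :=
  X10.bsdp_three_of_ram hYZ hGZK hX.2.1.1 hX.2.1.2 hX.2.2.1 hram
    (entireLFunction_one_ne_zero_or_analyticRank_eq_one hmod hX.analyticRank_le_one)

/-- **X10 ∩ padic-surj(3): `ClassX10 W 3 → (∀ n, ρ̄_{E,3^n} surjective) → BSDp W 3`**, from
Yan–Zhu 2026 Thm. 4.15 with (Im) witnessed by `(1 1; 0 1) ∈ SL₂(ℤ₃) = ρ_E(G_{ℚ(μ_{3^∞})})`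
(fact `hYZ`, special-case form), GZK, modularity. STATUS PUB\*: flag `YZ26@3-BF-ERL-Ohta`
(module appendix note; referee R9.1/R10.1). `3`-adic surjectivity is decided by the
mod-`9` image (Serre, *Abelian ℓ-adic representations*, IV-23 Lemma 3 and its `ℓ = 3` exercise;
Elkies 2006); mod-`3` surjectivity alone does not suffice.
[cite: YanZhu2024MainConjNonCM, Thm. 4.15 (§4.6)] -/
theorem bsdp_of_classX10_of_padicSurjective
    (hYZ : YanZhu2026.thm415_padicValRat_bsd_rank_le_one)
    (hGZK : rank_eq_analyticRank_of_analyticRank_le_one) (hmod : hasEntireLFunction_rat)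
    (hX : ClassX10 W 3) (hsurj : ∀ n : ℕ, W.HasSurjectiveModNGaloisRep (3 ^ n : ℕ)) : BSDp W 3 :=
  X10.bsdp_three_of_padicSurjective hYZ hGZK hX.2.1.1 hX.2.1.2 hX.2.2.1 hsurj
    (entireLFunction_one_ne_zero_or_analyticRank_eq_one hmod hX.analyticRank_le_one)

/-! ### Dedup bridge (referee F1 / R6.6): the two tree spellings of Skinner 2016 Thm. C agree -/

omit [W.IsElliptic] [W.IsGloballyMinimal] in
/-- The cell's spelling `Skinner2016.thmC_padicValRat_bsd_rank_zero` (bsd.S30 shape, with the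
torsion term `- 2·ord_p #E(ℚ)_tors`) and pub-bsdpct's `Skinner2016_padicValRat_bsd_rank_zero`
(file `LeadingTermPPartRankLeOne`, printed shape without torsion term) are EQUIVALENT: under
hypothesis (i) `E[p]` irreducible, `ord_p #E(ℚ)_tors = 0`
(`padicValNat_torsionOrder_eq_zero_of_irreducible`, Mazur 1977). So a single named fact is
load-bearing wherever either is cited. [cite: Skinner2016PacificMC, Thm. C (§1)] -/
theorem Skinner2016_thmC_iff_padicValRat_bsd_rank_zero :
    Skinner2016.thmC_padicValRat_bsd_rank_zero ↔ Skinner2016_padicValRat_bsd_rank_zero := by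
  constructor
  · intro h V _ _ p _ hp hred hirr hram hL hfin
    obtain ⟨q, hq, hv⟩ := h V p hp hred hirr hram hL hfin
    refine ⟨q, hq, ?_⟩
    rw [hv, padicValNat_torsionOrder_eq_zero_of_irreducible V p hirr]
    simp
  · intro h V _ _ p _ hp hred hirr hram hL hfin
    obtain ⟨q, hq, hv⟩ := h V p hp hred hirr hram hL hfin
    refine ⟨q, hq, ?_⟩
    rw [hv, padicValNat_torsionOrder_eq_zero_of_irreducible V p hirr]
    simp

/-! ### Appendix 2 (2026-08-18): X10 splits EXACTLY along the census bit `surj(3)`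

With Wuthrich, Doc. Math. 19 (2014), Lemma 20 (named fact
`Wuthrich2014.lemma20_surjective_threeAdic_of_semistable`: at a prime `3` of good or multiplicative
reduction, `ρ̄_{E,3}` surjective ⇒ `ρ_{E,3}` surjective — the mod-`3`-surjective, not-mod-`9`
curves of Elkies all have ADDITIVE reduction at `3`), the census bit `surj(3)` already witnesses
(Im) on class X10 (good reduction at `3`); and by the x9 seat's
`ClassX10.not_bigIm_of_not_surj` (file `Rank1Residual/X9SmallImage`, from Serre's Prop. 15 via
`WeierstrassCurve.not_exists_galoisRepTate_quotient_equiv`) the complement `¬surj(3)` has NO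
element `τ` with `T₃E/(τ-1) ≅ ℤ₃` at all. So the 34 census pairs of X10 (`N < 10⁴`) split as
30 = `surj(3)` (closed below, PUB\*) + 4 = `¬surj(3)` (`1210k1, 7442c1, 1690i1, 6050x1 @ 3`:
structurally outside (Im) — referee ruling R6.1, X10b). -/

/-- **X10 ∩ surj(3): `ClassX10 W 3 → Surj W 3 → BSDp W 3`.** Named facts: Yan–Zhu 2026 Thm. 4.15
(`hYZ`, PUB\*: flag `YZ26@3-BF-ERL-Ohta`, module appendix note, referee R9.1/R10.1),
Gross–Zagier–Kolyvagin (`hGZK`), modularity (`hmod`), and Wuthrich 2014 Lemma 20 (`hW20`: at the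
good prime `3` of the class, mod-`3` surjectivity gives `3`-adic surjectivity, hence (Im) with
`τ = (1 1; 0 1)`). Census reach (collector 2026-08-18T16:56:26Z): all 30 X10 pairs `N < 10⁴` with
`surj(3)` (28 of rank 1 — which also carry `ram(3)` — and `3136g1, 8624b1` of rank 0; the two
rank-`0` pairs are ALSO closed without Yan–Zhu, by Wuthrich Prop. 21 + `ord_3 #Ш_an = 0`,
`X10.bsdp_three_rankZero_surj_of_shaAn_unit` in `Rank1Residual/Typed/X10.lean` — referee R9.1 (iii)).
[cite: YanZhu2024MainConjNonCM, Thm. 4.15 (§4.6)] -/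
theorem bsdp_of_classX10_of_surj
    (hYZ : YanZhu2026.thm415_padicValRat_bsd_rank_le_one)
    (hGZK : rank_eq_analyticRank_of_analyticRank_le_one) (hmod : hasEntireLFunction_rat)
    (hW20 : Wuthrich2014.lemma20_surjective_threeAdic_of_semistable)
    (hX : ClassX10 W 3) (hsurj : Surj W 3) : BSDp W 3 :=
  bsdp_of_classX10_of_padicSurjective hYZ hGZK hmod hX (hW20 W (Or.inl hX.2.1.1) hsurj)

/-- **The X10 dichotomy on the census bit `surj(3)`.** For every `E/ℚ` in class X10 (`p = 3` good
ordinary, `E[3]` irreducible, off the printed floor): EITHER `ρ̄_{E,3}` is surjective and `BSD(E,3)`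
holds (Yan–Zhu 2026 Thm. 4.15 — PUB\*, flag `YZ26@3-BF-ERL-Ohta` (module appendix note; referee
R9.1/R10.1) — with Wuthrich 2014 Lemma 20, Gross–Zagier–Kolyvagin, modularity, all as named facts),
OR `ρ̄_{E,3}` is
not surjective and then the image hypothesis (Im) of every published `p`-part theorem fails for
`(E, 3)` (x9 seat's `ClassX10.not_bigIm_of_not_surj`, unconditional). The second alternative is
the typed residue X10b = "X9 at `p = 3`" (referee ruling R6.1); nothing here claims `BSD(E,3)`
for it. [cite: YanZhu2024MainConjNonCM, Thm. 4.15 (§4.6)] -/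
theorem classX10_dichotomy
    (hYZ : YanZhu2026.thm415_padicValRat_bsd_rank_le_one)
    (hGZK : rank_eq_analyticRank_of_analyticRank_le_one) (hmod : hasEntireLFunction_rat)
    (hW20 : Wuthrich2014.lemma20_surjective_threeAdic_of_semistable)
    (hX : ClassX10 W 3) : (Surj W 3 → BSDp W 3) ∧ (¬ Surj W 3 → ¬ BigIm W 3) :=
  ⟨bsdp_of_classX10_of_surj hYZ hGZK hmod hW20 hX, ClassX10.not_bigIm_of_not_surj W 3 hX⟩

end Literature.NumberTheory.EllipticCurves.Rank1Residual

end
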